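import Literature.Probability.LatticeModels.ScaleFrameTwoGraphsCore
import Literature.Probability.LatticeModels.ScaleFrameRelabel
import HarnessLib

/-!
# Ratio forgetting across two graphs sharing a window (Kesten's scheme, planarity-free), proved

Topic `Literature/Probability/LatticeModels` (trunk `StatMech`, family `crit-ising`). The abstract
two-graph statement (ABS-TWO) of the FK anchor-transfer line: two finite graphs `G₁, G₂` carrying
scale frames `F₁, F₂` (H. Kesten, PTRF 73 (1986), §2; D. Basu, A. Sapozhnikov, ECP 22 (2017), §2)
that agree (adjacency, radius, goodness) on a common vertex window `Wt` whose core `W₀` contains every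
good vertex below the top of the level-`L` block; anchors `x, x'` joined by base walks deep inside; far
targets `y₁, y₂`. Given Kesten's one-frame ratio forgetting (ABS-A) as the hypothesis `hABSA`
(universally quantified over frames), the double ratio of connection probabilities is at most
`Q L / (1 - (1-c)^(m/2))²` (`ScaleFrame.ratio_forgetting_two_graphs`, alias
`ratio_forgetting_two_graphs`).

The work is in `ScaleFrameTwoGraphsCore.lean` (`ratio_forgetting_two_graphs_of_ratioBound`: top-level
decomposition in each graph, junk `≤ (1-c)^{m/2}`, transport of the conditional inside probabilities
across the window, Doeblin averaging with `β = 0`). Here the hypothesis `hABSA`, which quantifies over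
frames on vertex types of ONE universe, is instantiated on the relabelled copy of `F₁` on
`ULift (Fin |V₁|)` (`ScaleFrameRelabel.lean`): the off-wired datum events and inside pieces of the
copy are the relabelled events (`real_datumOff_rel`, `real_datumOff_insidePiece_rel`), so the
one-frame ratio bound of the copy is that of `F₁`.

Everything is proved; no definitions, no named facts.

## References

* [Kesten1986] H. Kesten, *Probab. Theory Related Fields* 73 (1986) 369–394, proof of Thm. 3.
* [BasuSapozhnikov2017ECP] D. Basu, A. Sapozhnikov, ECP 22 (2017) no. 26, §2.
-/

open MeasureTheory Finset SimpleGraph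
open Literature.Probability.Percolation (BondConfig openConn openConnIn openCrossing explEvent sym2Equiv)

namespace Literature.Probability.LatticeModels

namespace ScaleFrame

/-! ### The off-wired datum events and inside pieces of a relabelled frame -/

section Rel

variable {V W : Type*} [Fintype V] [DecidableEq V] [Fintype W] [DecidableEq W]
  {F : ScaleFrame V} {F' : ScaleFrame W} {e : V ≃ W}

omit [Fintype V] [DecidableEq V] [Fintype W] [DecidableEq W] in
/-- The trace on the relabelled edges of a relabelled configuration is the relabelled trace.
[folklore] -/
theorem relabel_inter_map (e : V ≃ W) (E : Finset (Sym2 V)) (ω : BondConfig V) :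
    BondConfig.relabel (sym2Equiv e) ω ∩ ↑(E.map (sym2Equiv e).toEmbedding) =
      Sym2.map e '' (ω ∩ ↑E) := by
  rw [Finset.coe_map]
  change Sym2.map e '' ω ∩ Sym2.map e '' ↑E = _
  exact (Set.image_inter (Sym2.map.injective e.injective)).symm

/-- The off-wired datum event of the relabelled datum `(e U, e R)` in the relabelled frame is the
relabelled datum event. [cite: BasuSapozhnikov2017ECP, §2] -/
theorem relabel_mem_datumOff_iff (hrad : ∀ w, F'.rad w = F.rad (e.symm w))
    (hgood : ∀ w, w ∈ F'.good ↔ e.symm w ∈ F.good) {aL T : ℝ} {U R : Set V} {ω : BondConfig V} :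
    BondConfig.relabel (sym2Equiv e) ω ∈ {ω' : BondConfig W |
        ω' ∩ ↑(F.E.map (sym2Equiv e).toEmbedding) ∈
          explEvent (F'.inSet aL) (F'.annSet aL T) (e '' U) (e '' R) ∩
          {ω' | ∀ r ∈ e '' R, ∀ r₂ ∈ e '' R, ∃ v ∈ e '' U \ F'.inSet aL, ∃ v' ∈ e '' U \ F'.inSet aL,
            s(v, r) ∈ ω' ∧ s(v', r₂) ∈ ω' ∧ ω' ∈ openConnIn (e '' U \ F'.inSet aL) v v'}} ↔
      ω ∈ {ω : BondConfig V | ω ∩ ↑F.E ∈ explEvent (F.inSet aL) (F.annSet aL T) U R ∩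
          {ω | ∀ r ∈ R, ∀ r₂ ∈ R, ∃ v ∈ U \ F.inSet aL, ∃ v' ∈ U \ F.inSet aL,
            s(v, r) ∈ ω ∧ s(v', r₂) ∈ ω ∧ ω ∈ openConnIn (U \ F.inSet aL) v v'}} := by
  have h1 := image_mem_explEvent_iff e.toEmbedding (ω ∩ ↑F.E) (F.inSet aL) (F.annSet aL T) U R
  have h2 := image_rimWiredOff_iff e.toEmbedding (ω ∩ ↑F.E) (F.inSet aL) U R
  simp only [Equiv.coe_toEmbedding] at h1 h2
  rw [Set.mem_setOf_eq, Set.mem_setOf_eq, relabel_inter_map, inSet_rel hrad hgood,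
    annSet_rel hrad hgood, Set.mem_inter_iff, Set.mem_inter_iff, h1, Set.mem_setOf_eq,
    Set.mem_setOf_eq, h2]

omit [Fintype V] [DecidableEq V] [Fintype W] [DecidableEq W] in
/-- The inside piece of the relabelled datum at the relabelled anchor is the relabelled inside piece.
[cite: BasuSapozhnikov2017ECP, §2] -/
theorem relabel_mem_insidePiece_iff {E : Finset (Sym2 V)} {U R : Set V} {z : V} {ω : BondConfig V} :
    BondConfig.relabel (sym2Equiv e) ω ∈ {ω' : BondConfig W | ∃ w ∈ e '' R, ∃ v ∈ e '' U,
        ω' ∩ ↑(E.map (sym2Equiv e).toEmbedding) ∈ openConnIn (e '' U) (e z) v ∧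
          s(v, w) ∈ ω' ∩ ↑(E.map (sym2Equiv e).toEmbedding)} ↔
      ω ∈ {ω : BondConfig V | ∃ w ∈ R, ∃ v ∈ U, ω ∩ ↑E ∈ openConnIn U z v ∧ s(v, w) ∈ ω ∩ ↑E} := by
  have h := image_insidePiece_iff e.toEmbedding (ω ∩ ↑E) U R z
  simp only [Equiv.coe_toEmbedding] at h
  rw [Set.mem_setOf_eq, Set.mem_setOf_eq, relabel_inter_map, h]

/-- **The off-wired datum events of the relabelled frame have the probabilities of the original ones.**
[cite: BasuSapozhnikov2017ECP, §2] -/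
theorem real_datumOff_rel (hE : F'.E = F.E.map (sym2Equiv e).toEmbedding)
    (hrad : ∀ w, F'.rad w = F.rad (e.symm w)) (hgood : ∀ w, w ∈ F'.good ↔ e.symm w ∈ F.good)
    {p q : ℝ} (hp : p ∈ Set.Icc (0 : ℝ) 1) (hq : 0 < q) (aL T : ℝ) (U R : Set V) :
    (rcMeasure (fromEdgeSet (↑F'.E : Set (Sym2 W))) p q ∅).real {ω' : BondConfig W |
        ω' ∩ (↑F'.E : Set (Sym2 W)) ∈ explEvent (F'.inSet aL) (F'.annSet aL T) (e '' U) (e '' R) ∩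
          {ω' | ∀ r ∈ e '' R, ∀ r₂ ∈ e '' R, ∃ v ∈ e '' U \ F'.inSet aL, ∃ v' ∈ e '' U \ F'.inSet aL,
            s(v, r) ∈ ω' ∧ s(v', r₂) ∈ ω' ∧ ω' ∈ openConnIn (e '' U \ F'.inSet aL) v v'}} =
      (rcMeasure (fromEdgeSet (↑F.E : Set (Sym2 V))) p q ∅).real {ω : BondConfig V |
        ω ∩ (↑F.E : Set (Sym2 V)) ∈ explEvent (F.inSet aL) (F.annSet aL T) U R ∩
          {ω | ∀ r ∈ R, ∀ r₂ ∈ R, ∃ v ∈ U \ F.inSet aL, ∃ v' ∈ U \ F.inSet aL,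
            s(v, r) ∈ ω ∧ s(v', r₂) ∈ ω ∧ ω ∈ openConnIn (U \ F.inSet aL) v v'}} := by
  rw [hE, ← Set.image_empty e, real_rel e F.E hp hq ∅]
  congr 1
  ext ω
  rw [Set.mem_preimage]
  exact relabel_mem_datumOff_iff hrad hgood

/-- **The off-wired datum events met with the inside pieces, relabelled, have the same
probabilities.** [cite: BasuSapozhnikov2017ECP, §2] -/
theorem real_datumOff_insidePiece_rel (hE : F'.E = F.E.map (sym2Equiv e).toEmbedding)
    (hrad : ∀ w, F'.rad w = F.rad (e.symm w)) (hgood : ∀ w, w ∈ F'.good ↔ e.symm w ∈ F.good)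
    {p q : ℝ} (hp : p ∈ Set.Icc (0 : ℝ) 1) (hq : 0 < q) (aL T : ℝ) (z : V) (U R : Set V) :
    (rcMeasure (fromEdgeSet (↑F'.E : Set (Sym2 W))) p q ∅).real ({ω' : BondConfig W |
        ω' ∩ (↑F'.E : Set (Sym2 W)) ∈ explEvent (F'.inSet aL) (F'.annSet aL T) (e '' U) (e '' R) ∩
          {ω' | ∀ r ∈ e '' R, ∀ r₂ ∈ e '' R, ∃ v ∈ e '' U \ F'.inSet aL, ∃ v' ∈ e '' U \ F'.inSet aL,
            s(v, r) ∈ ω' ∧ s(v', r₂) ∈ ω' ∧ ω' ∈ openConnIn (e '' U \ F'.inSet aL) v v'}} ∩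
        {ω' | ∃ w ∈ e '' R, ∃ v ∈ e '' U,
          ω' ∩ (↑F'.E : Set (Sym2 W)) ∈ openConnIn (e '' U) (e z) v ∧
            s(v, w) ∈ ω' ∩ (↑F'.E : Set (Sym2 W))}) =
      (rcMeasure (fromEdgeSet (↑F.E : Set (Sym2 V))) p q ∅).real ({ω : BondConfig V |
        ω ∩ (↑F.E : Set (Sym2 V)) ∈ explEvent (F.inSet aL) (F.annSet aL T) U R ∩
          {ω | ∀ r ∈ R, ∀ r₂ ∈ R, ∃ v ∈ U \ F.inSet aL, ∃ v' ∈ U \ F.inSet aL,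
            s(v, r) ∈ ω ∧ s(v', r₂) ∈ ω ∧ ω ∈ openConnIn (U \ F.inSet aL) v v'}} ∩
        {ω | ∃ w ∈ R, ∃ v ∈ U, ω ∩ (↑F.E : Set (Sym2 V)) ∈ openConnIn U z v ∧
          s(v, w) ∈ ω ∩ (↑F.E : Set (Sym2 V))}) := by
  rw [hE, ← Set.image_empty e, real_rel e F.E hp hq ∅]
  congr 1
  ext ω
  rw [Set.mem_preimage, Set.mem_inter_iff, Set.mem_inter_iff, relabel_mem_datumOff_iff hrad hgood,
    relabel_mem_insidePiece_iff]

end Rel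

/-! ### ABS-TWO -/

/-- (ABS-TWO) test: ratio forgetting across two graphs sharing a window. Two finite graphs `G₁, G₂` carrying
scale frames `F₁, F₂` that agree (adjacency, radius, goodness) on a common vertex window `Wt` whose core `W₀`
contains every good vertex below the top of the level-`L` block; anchors `x, x'` joined by base walks deep
inside; far targets `y₁, y₂`. Given Kesten's one-frame ratio forgetting (ABS-A) as the hypothesis `hABSA`,
the double ratio of connection probabilities is at most `Q L / (1 - (1-c)^(m/2))²` (one-sided; swap the
roles of the graphs for the other side): top-level decomposition (TOP-off) in each graph, junk `≤ (1-c)^(m/2)`,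
transport of the conditional inside probabilities across the window (T-off), and the two-weight averaging
`ratio_div_ratio_le_of_overlap` with `β = 0`. [cite: Kesten1986, proof of Thm. 3] -/
theorem ratio_forgetting_two_graphs :
    ∀ {V₁ V₂ Wt : Type*} [Fintype V₁] [DecidableEq V₁] [Fintype V₂] [DecidableEq V₂] [Fintype Wt] [DecidableEq Wt]
      (G₁ : SimpleGraph V₁) [DecidableRel G₁.Adj] (G₂ : SimpleGraph V₂) [DecidableRel G₂.Adj]
      (ι₁ : Wt ↪ V₁) (ι₂ : Wt ↪ V₂) (W₀ : Set Wt) (F₁ : ScaleFrame V₁) (F₂ : ScaleFrame V₂)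
      {p q c a M : ℝ} {m g L : ℕ} (Q : ℕ → ℝ) (x x' : Wt) (y₁ : V₁) (y₂ : V₂),
      (∀ {V : Type*} [Fintype V] [DecidableEq V] (F : ScaleFrame V) {p q c a M : ℝ} {m g L : ℕ}, p ∈ Set.Ico (0 : ℝ) 1 → 1 ≤ q → 0 < c → c ≤ 1 → 0 < a → 4 ≤ M → 2 ≤ m → 1 ≤ g → 1 ≤ L → (1 - c) ^ (m / 2) < 1 → a * M ^ (L * (m + 17 + g) + m + 1) ≤ F.Rmax → F.η ≤ a → F.LadderRSWb p q c a M (L * (m + 17 + g) + m + 1) 13 → ∀ (x x' : V), (∃ w : (fromEdgeSet (↑F.E : Set (Sym2 V))).Walk x x', ∀ z ∈ w.support, z ∈ F.good ∧ F.rad z < a - F.η) → ∀ (Q : ℕ → ℝ), q ^ 8 / c ^ 20 / (1 - (1 - c) ^ (m / 2)) ^ 2 ≤ Q 1 → (∀ l : ℕ, 1 ≤ l → l < L → (1 / (q ^ 8 / c ^ 20) + (1 - 1 / (q ^ 8 / c ^ 20)) * Q l) / (1 - (1 - c) ^ (m / 2)) ^ 2 ≤ Q (l + 1)) → let P := rcMeasure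 (fromEdgeSet (↑F.E : Set (Sym2 V))) p q ∅; let aL : ℝ := a * M ^ (L * (m + 17 + g)); let Fd : Set V → Set V → Set (BondConfig V) := fun U R => {ω | ω ∩ (↑F.E : Set (Sym2 V)) ∈ explEvent (F.inSet aL) (F.annSet aL (aL * M ^ m)) U R ∩ {ω | ∀ r ∈ R, ∀ r₂ ∈ R, ∃ v ∈ U \ F.inSet aL, ∃ v' ∈ U \ F.inSet aL, s(v, r) ∈ ω ∧ s(v', r₂) ∈ ω ∧ ω ∈ openConnIn (U \ F.inSet aL) v v'}}; let InP : V → Set V → Set V → Set (BondConfig V) := fun y U R => {ω | ∃ w ∈ R, ∃ v ∈ U, ω ∩ (↑F.E : Set (Sym2 V)) ∈ openConnIn U y v ∧ s(v, w) ∈ ω ∩ (↑F.E : Set (Sym2 V))}; let u : V → Set V → Set V → ℝ := fun y U R => P.real (Fd U R ∩ InP y U R) / P.real (Fd U R); ∀ (U R U₂ R₂ : Set V), 0 < u x U R → 0 < u x U₂ R₂ → u x U R * u x' U₂ R₂ ≤ Q L * (u x' U R * u x U₂ R₂)) →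
      p ∈ Set.Ioo (0 : ℝ) 1 → 1 ≤ q → 0 < c → c ≤ 1 → 0 < a → 4 ≤ M → 2 ≤ m → 1 ≤ g → 1 ≤ L →
      (1 - c) ^ (m / 2) < 1 →
      a * M ^ (L * (m + 17 + g) + m + 1) ≤ F₁.Rmax → a * M ^ (L * (m + 17 + g) + m + 1) ≤ F₂.Rmax →
      F₁.η ≤ a → F₂.η ≤ a →
      F₁.E = G₁.edgeFinset → F₂.E = G₂.edgeFinset →
      F₁.LadderRSWb p q c a M (L * (m + 17 + g) + m + 1) 13 → F₂.LadderRSWb p q c a M (L * (m + 17 + g) + m + 1) 13 →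
      (∀ a b : Wt, G₁.Adj (ι₁ a) (ι₁ b) ↔ G₂.Adj (ι₂ a) (ι₂ b)) →
      (∀ w ∈ W₀, ∀ v : V₁, G₁.Adj (ι₁ w) v → ∃ b : Wt, v = ι₁ b) →
      (∀ w ∈ W₀, ∀ v : V₂, G₂.Adj (ι₂ w) v → ∃ b : Wt, v = ι₂ b) →
      (∀ w : Wt, F₁.rad (ι₁ w) = F₂.rad (ι₂ w)) → (∀ w : Wt, ι₁ w ∈ F₁.good ↔ ι₂ w ∈ F₂.good) →
      (∀ v : V₁, v ∈ F₁.good → F₁.rad v < a * M ^ (L * (m + 17 + g)) * M ^ m + 2 * F₁.η → ∃ w ∈ W₀, v = ι₁ w) →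
      (∀ v : V₂, v ∈ F₂.good → F₂.rad v < a * M ^ (L * (m + 17 + g)) * M ^ m + 2 * F₂.η → ∃ w ∈ W₀, v = ι₂ w) →
      (∃ w : (fromEdgeSet (↑F₁.E : Set (Sym2 V₁))).Walk (ι₁ x) (ι₁ x'), ∀ z ∈ w.support, z ∈ F₁.good ∧ F₁.rad z < a - F₁.η) →
      (∃ w : (fromEdgeSet (↑F₂.E : Set (Sym2 V₂))).Walk (ι₂ x) (ι₂ x'), ∀ z ∈ w.support, z ∈ F₂.good ∧ F₂.rad z < a - F₂.η) →
      (y₁ ∈ F₁.good → a * M ^ (L * (m + 17 + g)) * M ^ m + F₁.η ≤ F₁.rad y₁) →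
      (y₂ ∈ F₂.good → a * M ^ (L * (m + 17 + g)) * M ^ m + F₂.η ≤ F₂.rad y₂) →
      0 < (rcMeasure G₁ p q ∅).real (openConn (ι₁ x) y₁) → 0 < (rcMeasure G₁ p q ∅).real (openConn (ι₁ x') y₁) →
      0 < (rcMeasure G₂ p q ∅).real (openConn (ι₂ x) y₂) → 0 < (rcMeasure G₂ p q ∅).real (openConn (ι₂ x') y₂) →
      q ^ 8 / c ^ 20 / (1 - (1 - c) ^ (m / 2)) ^ 2 ≤ Q 1 →
      (∀ l : ℕ, 1 ≤ l → l < L →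
        (1 / (q ^ 8 / c ^ 20) + (1 - 1 / (q ^ 8 / c ^ 20)) * Q l) / (1 - (1 - c) ^ (m / 2)) ^ 2 ≤ Q (l + 1)) →
      (rcMeasure G₁ p q ∅).real (openConn (ι₁ x) y₁) * (rcMeasure G₂ p q ∅).real (openConn (ι₂ x') y₂) ≤
        Q L / (1 - (1 - c) ^ (m / 2)) ^ 2 *
          ((rcMeasure G₁ p q ∅).real (openConn (ι₁ x') y₁) * (rcMeasure G₂ p q ∅).real (openConn (ι₂ x) y₂)) := by
  intro V₁ V₂ Wt _ _ _ _ _ _ G₁ _ G₂ _ ι₁ ι₂ W₀ F₁ F₂ p q c a M m g L Q x x' y₁ y₂ hABSA hp hq hc hc1 ha hM hm hg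
    hL1 hε hR₁ hR₂ hη₁ hη₂ hE₁ hE₂ hL₁ hL₂ hadj hnb₁ hnb₂ hrad hgood hcore₁ hcore₂ hw₁ hw₂ hy₁ hy₂ hN₁ hM₁
    hN₂ hM₂ hQ1 hQ
  refine ratio_forgetting_two_graphs_of_ratioBound G₁ G₂ ι₁ ι₂ W₀ F₁ F₂ Q x x' y₁ y₂ ?_ hp hq hc1 ha hM
    hm hε hR₁ hR₂ hη₁ hη₂ hE₁ hE₂ hL₁ hL₂ hadj hnb₁ hnb₂ hrad hgood hcore₁ hcore₂ hw₁ hw₂ hy₁ hy₂ hN₁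
    hM₁ hN₂ hM₂
  -- the one-frame ratio bound of `F₁`, through its relabelled copy in the universe of `hABSA`
  have hp' : p ∈ Set.Icc (0 : ℝ) 1 := ⟨hp.1.le, hp.2.le⟩
  have hq0 : 0 < q := one_pos.trans_le hq
  obtain ⟨e, -⟩ : ∃ _e : V₁ ≃ ULift.{u_4} (Fin (Fintype.card V₁)), True :=
    ⟨(Fintype.equivFin V₁).trans Equiv.ulift.symm, trivial⟩
  obtain ⟨F', hE', hrad', hgood', hη', hR'⟩ := F₁.exists_relabel e
  have hL' := ladderRSWb_rel hE' hrad' hgood' hp' hq0 hL₁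
  have hw' := exists_walk_rel hE' hrad' hgood' hw₁
  rw [← hη'] at hw'
  have h := hABSA F' ⟨hp.1.le, hp.2⟩ hq hc hc1 ha hM hm hg hL1 hε (by rw [hR']; exact hR₁)
    (by rw [hη']; exact hη₁) hL' (e (ι₁ x)) (e (ι₁ x')) hw' Q hQ1 hQ
  dsimp only at h ⊢
  intro U R U₂ R₂
  have key := h (e '' U) (e '' R) (e '' U₂) (e '' R₂)
  rw [real_datumOff_insidePiece_rel hE' hrad' hgood' hp' hq0 _ _ (ι₁ x) U R,
    real_datumOff_insidePiece_rel hE' hrad' hgood' hp' hq0 _ _ (ι₁ x) U₂ R₂,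
    real_datumOff_insidePiece_rel hE' hrad' hgood' hp' hq0 _ _ (ι₁ x') U R,
    real_datumOff_insidePiece_rel hE' hrad' hgood' hp' hq0 _ _ (ι₁ x') U₂ R₂,
    real_datumOff_rel hE' hrad' hgood' hp' hq0 _ _ U R,
    real_datumOff_rel hE' hrad' hgood' hp' hq0 _ _ U₂ R₂] at key
  exact key

end ScaleFrame

/-- (ABS-TWO) test: ratio forgetting across two graphs sharing a window. Two finite graphs `G₁, G₂` carrying
scale frames `F₁, F₂` that agree (adjacency, radius, goodness) on a common vertex window `Wt` whose core `W₀`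
contains every good vertex below the top of the level-`L` block; anchors `x, x'` joined by base walks deep
inside; far targets `y₁, y₂`. Given Kesten's one-frame ratio forgetting (ABS-A) as the hypothesis `hABSA`,
the double ratio of connection probabilities is at most `Q L / (1 - (1-c)^(m/2))²` (one-sided; swap the
roles of the graphs for the other side): top-level decomposition (TOP-off) in each graph, junk `≤ (1-c)^(m/2)`,
transport of the conditional inside probabilities across the window (T-off), and the two-weight averaging
`ratio_div_ratio_le_of_overlap` with `β = 0` (alias of `ScaleFrame.ratio_forgetting_two_graphs`).
[cite: Kesten1986, proof of Thm. 3] -/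
theorem ratio_forgetting_two_graphs :
    ∀ {V₁ V₂ Wt : Type*} [Fintype V₁] [DecidableEq V₁] [Fintype V₂] [DecidableEq V₂] [Fintype Wt] [DecidableEq Wt]
      (G₁ : SimpleGraph V₁) [DecidableRel G₁.Adj] (G₂ : SimpleGraph V₂) [DecidableRel G₂.Adj]
      (ι₁ : Wt ↪ V₁) (ι₂ : Wt ↪ V₂) (W₀ : Set Wt) (F₁ : ScaleFrame V₁) (F₂ : ScaleFrame V₂)
      {p q c a M : ℝ} {m g L : ℕ} (Q : ℕ → ℝ) (x x' : Wt) (y₁ : V₁) (y₂ : V₂),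
      (∀ {V : Type*} [Fintype V] [DecidableEq V] (F : ScaleFrame V) {p q c a M : ℝ} {m g L : ℕ}, p ∈ Set.Ico (0 : ℝ) 1 → 1 ≤ q → 0 < c → c ≤ 1 → 0 < a → 4 ≤ M → 2 ≤ m → 1 ≤ g → 1 ≤ L → (1 - c) ^ (m / 2) < 1 → a * M ^ (L * (m + 17 + g) + m + 1) ≤ F.Rmax → F.η ≤ a → F.LadderRSWb p q c a M (L * (m + 17 + g) + m + 1) 13 → ∀ (x x' : V), (∃ w : (fromEdgeSet (↑F.E : Set (Sym2 V))).Walk x x', ∀ z ∈ w.support, z ∈ F.good ∧ F.rad z < a - F.η) → ∀ (Q : ℕ → ℝ), q ^ 8 / c ^ 20 / (1 - (1 - c) ^ (m / 2)) ^ 2 ≤ Q 1 → (∀ l : ℕ, 1 ≤ l → l < L → (1 / (q ^ 8 / c ^ 20) + (1 - 1 / (q ^ 8 / c ^ 20)) * Q l) / (1 - (1 - c) ^ (m / 2)) ^ 2 ≤ Q (l + 1)) → let P := rcMeasure (fromEdgeSet (↑F.E : Set (Sym2 V))) p q ∅; let aL : ℝ := a * M ^ (L * (m + 17 + g)); let Fd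 : Set V → Set V → Set (BondConfig V) := fun U R => {ω | ω ∩ (↑F.E : Set (Sym2 V)) ∈ explEvent (F.inSet aL) (F.annSet aL (aL * M ^ m)) U R ∩ {ω | ∀ r ∈ R, ∀ r₂ ∈ R, ∃ v ∈ U \ F.inSet aL, ∃ v' ∈ U \ F.inSet aL, s(v, r) ∈ ω ∧ s(v', r₂) ∈ ω ∧ ω ∈ openConnIn (U \ F.inSet aL) v v'}}; let InP : V → Set V → Set V → Set (BondConfig V) := fun y U R => {ω | ∃ w ∈ R, ∃ v ∈ U, ω ∩ (↑F.E : Set (Sym2 V)) ∈ openConnIn U y v ∧ s(v, w) ∈ ω ∩ (↑F.E : Set (Sym2 V))}; let u : V → Set V → Set V → ℝ := fun y U R => P.real (Fd U R ∩ InP y U R) / P.real (Fd U R); ∀ (U R U₂ R₂ : Set V), 0 < u x U R → 0 < u x U₂ R₂ → u x U R * u x' U₂ R₂ ≤ Q L * (u x' U R * u x U₂ R₂)) →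
      p ∈ Set.Ioo (0 : ℝ) 1 → 1 ≤ q → 0 < c → c ≤ 1 → 0 < a → 4 ≤ M → 2 ≤ m → 1 ≤ g → 1 ≤ L →
      (1 - c) ^ (m / 2) < 1 →
      a * M ^ (L * (m + 17 + g) + m + 1) ≤ F₁.Rmax → a * M ^ (L * (m + 17 + g) + m + 1) ≤ F₂.Rmax →
      F₁.η ≤ a → F₂.η ≤ a →
      F₁.E = G₁.edgeFinset → F₂.E = G₂.edgeFinset →
      F₁.LadderRSWb p q c a M (L * (m + 17 + g) + m + 1) 13 → F₂.LadderRSWb p q c a M (L * (m + 17 + g) + m + 1) 13 →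
      (∀ a b : Wt, G₁.Adj (ι₁ a) (ι₁ b) ↔ G₂.Adj (ι₂ a) (ι₂ b)) →
      (∀ w ∈ W₀, ∀ v : V₁, G₁.Adj (ι₁ w) v → ∃ b : Wt, v = ι₁ b) →
      (∀ w ∈ W₀, ∀ v : V₂, G₂.Adj (ι₂ w) v → ∃ b : Wt, v = ι₂ b) →
      (∀ w : Wt, F₁.rad (ι₁ w) = F₂.rad (ι₂ w)) → (∀ w : Wt, ι₁ w ∈ F₁.good ↔ ι₂ w ∈ F₂.good) →
      (∀ v : V₁, v ∈ F₁.good → F₁.rad v < a * M ^ (L * (m + 17 + g)) * M ^ m + 2 * F₁.η → ∃ w ∈ W₀, v = ι₁ w) →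
      (∀ v : V₂, v ∈ F₂.good → F₂.rad v < a * M ^ (L * (m + 17 + g)) * M ^ m + 2 * F₂.η → ∃ w ∈ W₀, v = ι₂ w) →
      (∃ w : (fromEdgeSet (↑F₁.E : Set (Sym2 V₁))).Walk (ι₁ x) (ι₁ x'), ∀ z ∈ w.support, z ∈ F₁.good ∧ F₁.rad z < a - F₁.η) →
      (∃ w : (fromEdgeSet (↑F₂.E : Set (Sym2 V₂))).Walk (ι₂ x) (ι₂ x'), ∀ z ∈ w.support, z ∈ F₂.good ∧ F₂.rad z < a - F₂.η) →
      (y₁ ∈ F₁.good → a * M ^ (L * (m + 17 + g)) * M ^ m + F₁.η ≤ F₁.rad y₁) →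
      (y₂ ∈ F₂.good → a * M ^ (L * (m + 17 + g)) * M ^ m + F₂.η ≤ F₂.rad y₂) →
      0 < (rcMeasure G₁ p q ∅).real (openConn (ι₁ x) y₁) → 0 < (rcMeasure G₁ p q ∅).real (openConn (ι₁ x') y₁) →
      0 < (rcMeasure G₂ p q ∅).real (openConn (ι₂ x) y₂) → 0 < (rcMeasure G₂ p q ∅).real (openConn (ι₂ x') y₂) →
      q ^ 8 / c ^ 20 / (1 - (1 - c) ^ (m / 2)) ^ 2 ≤ Q 1 →
      (∀ l : ℕ, 1 ≤ l → l < L →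
        (1 / (q ^ 8 / c ^ 20) + (1 - 1 / (q ^ 8 / c ^ 20)) * Q l) / (1 - (1 - c) ^ (m / 2)) ^ 2 ≤ Q (l + 1)) →
      (rcMeasure G₁ p q ∅).real (openConn (ι₁ x) y₁) * (rcMeasure G₂ p q ∅).real (openConn (ι₂ x') y₂) ≤
        Q L / (1 - (1 - c) ^ (m / 2)) ^ 2 *
          ((rcMeasure G₁ p q ∅).real (openConn (ι₁ x') y₁) * (rcMeasure G₂ p q ∅).real (openConn (ι₂ x) y₂)) :=
  ScaleFrame.ratio_forgetting_two_graphs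

end Literature.Probability.LatticeModels
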